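import Mathlib
import Literature.Probability.Distributions.GaussianLinearCompensation

/-!
# Elementary matrix toolkit for the «sfm-bl» line (item `CandCutNormSigningFP`, stmt-PneNP-20523)

FRONTIER F-N1c; nothing here bears on P vs NP.

The derandomised-signing argument (pnp-ideate-p3 PROOF-SFM-BL.md) needs, for a real SYMMETRIC matrix `A`
(the signed adjacency matrix of the sparse remainder), only two spectral facts, both provable WITHOUT
eigenvalues:
* `trace_pow_le_of_rayleigh`: a Rayleigh-quotient bound `|yᵀAy| ≤ ρ‖y‖²` (the conclusion of Bilu–Linial's
  Lemma 3.3) gives `tr(A^{2k}) ≤ N·ρ^{2k}` — via polarisation (`mulVec_normSq_le_of_rayleigh`: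
  `‖Ay‖² ≤ ρ²‖y‖²`) and `tr(A^{2k}) = Σᵢ ‖A^k eᵢ‖²`;
* `quadForm_pow_le_trace`: conversely `(zᵀAz)^L ≤ ‖z‖^{2L}·tr(A^L)` for `L = 2^{j+2}`, i.e.
  `|zᵀAz| ≤ ‖z‖²·tr(A^L)^{1/L}` — iterated Cauchy–Schwarz (`quadForm_sq_le`, `quadForm_pow_le`) plus the
  Frobenius bound (`quadForm_sq_le_frobenius`, `Σᵢⱼ(A^l)ᵢⱼ² = tr(A^{2l})`); this is Lemma 2(b) of the proof
  document with `tr(A^L)^{1/L}` in place of `λ_max`, used after the conditional-expectation greedy.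
So the whole line needs no spectral theorem: Bilu–Linial 3.3 enters as a Rayleigh bound, leaves as a trace
bound, and the trace bound returns as a cut-norm bound.
-/

namespace Summit.PneNP.PneNP.Theorems.SfmBl

open Matrix Finset BigOperators

variable {ι : Type} [Fintype ι]

-- Cauchy–Schwarz `(u·w)² ≤ (u·u)(w·w)` is `Literature.Probability.Distributions.dotProduct_sq_le` (reused).

/-- For symmetric `A`: `(A x)·y = x·(A y)`. -/
theorem mulVec_dotProduct_of_isSymm (A : Matrix ι ι ℝ) (hA : A.IsSymm)
    (x y : ι → ℝ) : (A *ᵥ x) ⬝ᵥ y = x ⬝ᵥ (A *ᵥ y) := by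
  calc (A *ᵥ x) ⬝ᵥ y = (Aᵀ *ᵥ x) ⬝ᵥ y := by rw [hA.eq]
    _ = (x ᵥ* A) ⬝ᵥ y := by rw [Matrix.mulVec_transpose]
    _ = x ⬝ᵥ (A *ᵥ y) := by rw [Matrix.dotProduct_mulVec]

/-- Symmetry of the bilinear form of a symmetric matrix. -/
theorem dotProduct_mulVec_comm_of_isSymm (A : Matrix ι ι ℝ) (hA : A.IsSymm)
    (x y : ι → ℝ) : x ⬝ᵥ (A *ᵥ y) = y ⬝ᵥ (A *ᵥ x) := by
  rw [← mulVec_dotProduct_of_isSymm A hA, dotProduct_comm]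

/-- One Cauchy–Schwarz step: `(zᵀAz)² ≤ (zᵀz)·(zᵀA²z)` for symmetric `A`. -/
theorem quadForm_sq_le (A : Matrix ι ι ℝ) (hA : A.IsSymm) (z : ι → ℝ) :
    (z ⬝ᵥ (A *ᵥ z)) ^ 2 ≤ (z ⬝ᵥ z) * (z ⬝ᵥ ((A * A) *ᵥ z)) := by
  have h := Literature.Probability.Distributions.dotProduct_sq_le z (A *ᵥ z)
  have h2 : (A *ᵥ z) ⬝ᵥ (A *ᵥ z) = z ⬝ᵥ ((A * A) *ᵥ z) := by
    rw [mulVec_dotProduct_of_isSymm A hA, Matrix.mulVec_mulVec]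
  rw [← h2]
  exact h

/-- `‖Ay‖²` expressed through the bilinear form: `(A x)·(A x) = x·(A² x)`. -/
theorem mulVec_normSq_eq (A : Matrix ι ι ℝ) (hA : A.IsSymm) (x : ι → ℝ) :
    (A *ᵥ x) ⬝ᵥ (A *ᵥ x) = x ⬝ᵥ ((A * A) *ᵥ x) := by
  rw [mulVec_dotProduct_of_isSymm A hA, Matrix.mulVec_mulVec]

/-- POLARISATION: a Rayleigh-quotient bound `|yᵀAy| ≤ ρ·(yᵀy)` for a symmetric `A` gives the operator-norm
bound `‖Ax‖² ≤ ρ²‖x‖²`, with no spectral theorem. -/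
theorem mulVec_normSq_le_of_rayleigh (A : Matrix ι ι ℝ) (hA : A.IsSymm) {ρ : ℝ}
    (hρ : 0 < ρ) (h : ∀ y : ι → ℝ, |y ⬝ᵥ (A *ᵥ y)| ≤ ρ * (y ⬝ᵥ y)) (x : ι → ℝ) :
    (A *ᵥ x) ⬝ᵥ (A *ᵥ x) ≤ ρ ^ 2 * (x ⬝ᵥ x) := by
  set w : ι → ℝ := A *ᵥ x with hw
  set y : ι → ℝ := ρ⁻¹ • w with hy
  -- the bilinear form at (x, y)
  have hxAy : x ⬝ᵥ (A *ᵥ y) = ρ⁻¹ * (w ⬝ᵥ w) := by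
    rw [hy, Matrix.mulVec_smul, dotProduct_smul, smul_eq_mul, ← mulVec_dotProduct_of_isSymm A hA]
  have hyy : y ⬝ᵥ y = ρ⁻¹ ^ 2 * (w ⬝ᵥ w) := by
    rw [hy, smul_dotProduct, dotProduct_smul, smul_eq_mul, smul_eq_mul]; ring
  -- polarisation identity
  have hpol : 4 * (x ⬝ᵥ (A *ᵥ y))
      = (x + y) ⬝ᵥ (A *ᵥ (x + y)) - (x - y) ⬝ᵥ (A *ᵥ (x - y)) := by
    have hs := dotProduct_mulVec_comm_of_isSymm A hA y x
    simp only [Matrix.mulVec_add, Matrix.mulVec_sub, add_dotProduct, sub_dotProduct, dotProduct_add,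
      dotProduct_sub]
    rw [hs]; ring
  have hnorm : (x + y) ⬝ᵥ (x + y) + (x - y) ⬝ᵥ (x - y) = 2 * (x ⬝ᵥ x) + 2 * (y ⬝ᵥ y) := by
    simp only [add_dotProduct, sub_dotProduct, dotProduct_add, dotProduct_sub]
    rw [dotProduct_comm y x]; ring
  have h1 := h (x + y)
  have h2 := h (x - y)
  have hle : 4 * (x ⬝ᵥ (A *ᵥ y)) ≤ ρ * (2 * (x ⬝ᵥ x) + 2 * (y ⬝ᵥ y)) := by
    rw [hpol, ← hnorm, mul_add]
    have e1 := le_abs_self ((x + y) ⬝ᵥ (A *ᵥ (x + y)))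
    have e2 := neg_abs_le ((x - y) ⬝ᵥ (A *ᵥ (x - y)))
    linarith
  rw [hxAy, hyy] at hle
  -- 4ρ⁻¹ W ≤ 2ρ X + 2ρ·ρ⁻² W  ⇒  W ≤ ρ² X
  have hW : 0 ≤ w ⬝ᵥ w := by
    simpa [dotProduct, pow_two] using Finset.sum_nonneg (fun i _ => mul_self_nonneg (w i))
  have hρinv : ρ * ρ⁻¹ = 1 := mul_inv_cancel₀ hρ.ne'
  have key : ρ⁻¹ * (w ⬝ᵥ w) ≤ ρ * (x ⬝ᵥ x) := by
    have : ρ * (2 * (ρ⁻¹ ^ 2 * (w ⬝ᵥ w))) = 2 * (ρ⁻¹ * (w ⬝ᵥ w)) := by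
      field_simp
    nlinarith [this]
  calc w ⬝ᵥ w = ρ * (ρ⁻¹ * (w ⬝ᵥ w)) := by rw [← mul_assoc, hρinv, one_mul]
    _ ≤ ρ * (ρ * (x ⬝ᵥ x)) := mul_le_mul_of_nonneg_left key hρ.le
    _ = ρ ^ 2 * (x ⬝ᵥ x) := by ring

/-- Iterating the polarisation bound: `‖A^k x‖² ≤ ρ^{2k} ‖x‖²`. -/
theorem pow_mulVec_normSq_le_of_rayleigh [DecidableEq ι] (A : Matrix ι ι ℝ) (hA : A.IsSymm) {ρ : ℝ}
    (hρ : 0 < ρ) (h : ∀ y : ι → ℝ, |y ⬝ᵥ (A *ᵥ y)| ≤ ρ * (y ⬝ᵥ y)) (k : ℕ) (x : ι → ℝ) :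
    ((A ^ k) *ᵥ x) ⬝ᵥ ((A ^ k) *ᵥ x) ≤ ρ ^ (2 * k) * (x ⬝ᵥ x) := by
  induction k generalizing x with
  | zero => simp
  | succ k ih =>
    rw [pow_succ, ← Matrix.mulVec_mulVec]
    calc ((A ^ k) *ᵥ (A *ᵥ x)) ⬝ᵥ ((A ^ k) *ᵥ (A *ᵥ x))
        ≤ ρ ^ (2 * k) * ((A *ᵥ x) ⬝ᵥ (A *ᵥ x)) := ih (A *ᵥ x)
      _ ≤ ρ ^ (2 * k) * (ρ ^ 2 * (x ⬝ᵥ x)) :=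
          mul_le_mul_of_nonneg_left (mulVec_normSq_le_of_rayleigh A hA hρ h x) (by positivity)
      _ = ρ ^ (2 * (k + 1)) * (x ⬝ᵥ x) := by ring

/-- The diagonal entry `(A^{2k})ᵢᵢ` is `‖A^k eᵢ‖²` for symmetric `A`. -/
theorem pow_two_mul_apply_diag [DecidableEq ι] (A : Matrix ι ι ℝ) (hA : A.IsSymm) (k : ℕ) (i : ι) :
    (A ^ (2 * k)) i i = ((A ^ k) *ᵥ Pi.single i 1) ⬝ᵥ ((A ^ k) *ᵥ Pi.single i 1) := by
  have hAk : (A ^ k).IsSymm := hA.pow k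
  rw [mulVec_dotProduct_of_isSymm _ hAk, Matrix.mulVec_mulVec, ← pow_add,
    show k + k = 2 * k by ring]
  -- `e_i ⬝ (M *ᵥ e_i) = M i i`
  rw [single_dotProduct, Matrix.mulVec_single]
  simp

/-- TRACE BOUND WITHOUT EIGENVALUES: a Rayleigh-quotient bound `|yᵀAy| ≤ ρ‖y‖²` for a symmetric `N × N`
matrix gives `tr(A^{2k}) ≤ N·ρ^{2k}` (`N = |ι|`). (This is how the sfm-bl line consumes Bilu–Linial's Lemma 3.3 on the
good event.) -/
theorem trace_pow_le_of_rayleigh [DecidableEq ι] (A : Matrix ι ι ℝ) (hA : A.IsSymm) {ρ : ℝ}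
    (hρ : 0 < ρ) (h : ∀ y : ι → ℝ, |y ⬝ᵥ (A *ᵥ y)| ≤ ρ * (y ⬝ᵥ y)) (k : ℕ) :
    (A ^ (2 * k)).trace ≤ Fintype.card ι * ρ ^ (2 * k) := by
  unfold Matrix.trace
  calc ∑ i, (A ^ (2 * k)).diag i = ∑ i, ((A ^ k) *ᵥ Pi.single i 1) ⬝ᵥ ((A ^ k) *ᵥ Pi.single i 1) := by
        refine Finset.sum_congr rfl fun i _ => ?_
        rw [Matrix.diag_apply, pow_two_mul_apply_diag A hA k i]
    _ ≤ ∑ _i : ι, ρ ^ (2 * k) := by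
        refine Finset.sum_le_sum fun i _ => ?_
        have := pow_mulVec_normSq_le_of_rayleigh A hA hρ h k (Pi.single i 1)
        simpa using this
    _ = Fintype.card ι * ρ ^ (2 * k) := by simp


/-! ### The converse direction: small `tr(A^{2l})` ⇒ small quadratic form (no eigenvalues) -/

/-- FROBENIUS: `(zᵀMz)² ≤ ‖z‖⁴ · Σᵢⱼ Mᵢⱼ²` for any real square matrix `M`. -/
theorem quadForm_sq_le_frobenius (M : Matrix ι ι ℝ) (z : ι → ℝ) :
    (z ⬝ᵥ (M *ᵥ z)) ^ 2 ≤ (z ⬝ᵥ z) ^ 2 * ∑ i, ∑ j, (M i j) ^ 2 := by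
  have h1 := Literature.Probability.Distributions.dotProduct_sq_le z (M *ᵥ z)
  have hz : 0 ≤ z ⬝ᵥ z := by
    simpa [dotProduct, pow_two] using Finset.sum_nonneg (fun i _ => mul_self_nonneg (z i))
  -- row-wise Cauchy–Schwarz: ‖Mz‖² ≤ (Σᵢⱼ Mᵢⱼ²) ‖z‖²
  have h2 : (M *ᵥ z) ⬝ᵥ (M *ᵥ z) ≤ (∑ i, ∑ j, (M i j) ^ 2) * (z ⬝ᵥ z) := by
    have hrow : ∀ i, (M *ᵥ z) i * (M *ᵥ z) i ≤ (∑ j, (M i j) ^ 2) * (z ⬝ᵥ z) := by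
      intro i
      have hcs := Finset.sum_mul_sq_le_sq_mul_sq (Finset.univ : Finset ι) (M i) z
      have hzz : z ⬝ᵥ z = ∑ j, z j ^ 2 := by simp [dotProduct, pow_two]
      rw [hzz, ← pow_two]
      simpa [Matrix.mulVec, dotProduct] using hcs
    calc (M *ᵥ z) ⬝ᵥ (M *ᵥ z) = ∑ i, (M *ᵥ z) i * (M *ᵥ z) i := rfl
      _ ≤ ∑ i, (∑ j, (M i j) ^ 2) * (z ⬝ᵥ z) := Finset.sum_le_sum fun i _ => hrow i
      _ = (∑ i, ∑ j, (M i j) ^ 2) * (z ⬝ᵥ z) := by rw [Finset.sum_mul]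
  calc (z ⬝ᵥ (M *ᵥ z)) ^ 2 ≤ (z ⬝ᵥ z) * ((M *ᵥ z) ⬝ᵥ (M *ᵥ z)) := h1
    _ ≤ (z ⬝ᵥ z) * ((∑ i, ∑ j, (M i j) ^ 2) * (z ⬝ᵥ z)) := mul_le_mul_of_nonneg_left h2 hz
    _ = (z ⬝ᵥ z) ^ 2 * ∑ i, ∑ j, (M i j) ^ 2 := by ring

/-- `Σᵢⱼ Mᵢⱼ² = tr(M Mᵀ)`. -/
theorem sum_sq_eq_trace_mul_transpose (M : Matrix ι ι ℝ) :
    ∑ i, ∑ j, (M i j) ^ 2 = (M * Mᵀ).trace := by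
  simp [Matrix.trace, Matrix.mul_apply, pow_two]

/-- For symmetric `A`: `Σᵢⱼ (A^l)ᵢⱼ² = tr(A^{2l})`. -/
theorem sum_sq_pow_eq_trace [DecidableEq ι] (A : Matrix ι ι ℝ) (hA : A.IsSymm) (l : ℕ) :
    ∑ i, ∑ j, ((A ^ l) i j) ^ 2 = (A ^ (2 * l)).trace := by
  rw [sum_sq_eq_trace_mul_transpose, (hA.pow l).eq, ← pow_add, show l + l = 2 * l by ring]

/-- ITERATED CAUCHY–SCHWARZ: `‖z‖² · (zᵀAz)^{2^{j+1}} ≤ ‖z‖^{2^{j+2}} · zᵀA^{2^{j+1}}z`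
(stated with a spare factor `‖z‖²` on the left to avoid natural-number subtraction in exponents). -/
theorem quadForm_pow_le [DecidableEq ι] (A : Matrix ι ι ℝ) (hA : A.IsSymm) (z : ι → ℝ) (j : ℕ) :
    (z ⬝ᵥ z) * (z ⬝ᵥ (A *ᵥ z)) ^ (2 ^ (j + 1))
      ≤ (z ⬝ᵥ z) ^ (2 ^ (j + 1)) * (z ⬝ᵥ ((A ^ (2 ^ (j + 1))) *ᵥ z)) := by
  have hz : 0 ≤ z ⬝ᵥ z := by
    simpa [dotProduct, pow_two] using Finset.sum_nonneg (fun i _ => mul_self_nonneg (z i))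
  induction j with
  | zero =>
    have h := quadForm_sq_le A hA z
    have e1 : (2 : ℕ) ^ (0 + 1) = 2 := by norm_num
    rw [e1, pow_two A]
    calc (z ⬝ᵥ z) * (z ⬝ᵥ (A *ᵥ z)) ^ 2 ≤ (z ⬝ᵥ z) * ((z ⬝ᵥ z) * (z ⬝ᵥ ((A * A) *ᵥ z))) :=
          mul_le_mul_of_nonneg_left h hz
      _ = (z ⬝ᵥ z) ^ 2 * (z ⬝ᵥ ((A * A) *ᵥ z)) := by ring
  | succ j ih =>
    -- notation
    set B : Matrix ι ι ℝ := A ^ (2 ^ (j + 1)) with hB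
    have hBs : B.IsSymm := hA.pow _
    have hBB : B * B = A ^ (2 ^ (j + 2)) := by
      rw [hB, ← pow_add]; congr 1; ring
    set X : ℝ := z ⬝ᵥ z with hX
    set q : ℝ := z ⬝ᵥ (A *ᵥ z) with hq
    -- square the induction hypothesis (both sides are ≥ 0)
    have hL : 0 ≤ X * q ^ (2 ^ (j + 1)) := by
      have : 0 ≤ q ^ (2 ^ (j + 1)) := by
        rw [pow_succ, pow_mul]; positivity
      exact mul_nonneg hz this
    have hsq : (X * q ^ (2 ^ (j + 1))) ^ 2 ≤ (X ^ (2 ^ (j + 1)) * (z ⬝ᵥ (B *ᵥ z))) ^ 2 :=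
      pow_le_pow_left₀ hL ih 2
    -- one Cauchy–Schwarz step on `B`
    have hcs : (z ⬝ᵥ (B *ᵥ z)) ^ 2 ≤ X * (z ⬝ᵥ ((B * B) *ᵥ z)) := quadForm_sq_le B hBs z
    have hXpow : 0 ≤ X ^ (2 ^ (j + 1)) := pow_nonneg hz _
    have main : (X * q ^ (2 ^ (j + 1))) ^ 2
        ≤ (X ^ (2 ^ (j + 1))) ^ 2 * (X * (z ⬝ᵥ ((B * B) *ᵥ z))) := by
      calc (X * q ^ (2 ^ (j + 1))) ^ 2 ≤ (X ^ (2 ^ (j + 1)) * (z ⬝ᵥ (B *ᵥ z))) ^ 2 := hsq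
        _ = (X ^ (2 ^ (j + 1))) ^ 2 * (z ⬝ᵥ (B *ᵥ z)) ^ 2 := by ring
        _ ≤ (X ^ (2 ^ (j + 1))) ^ 2 * (X * (z ⬝ᵥ ((B * B) *ᵥ z))) :=
            mul_le_mul_of_nonneg_left hcs (by positivity)
    rw [hBB] at main
    -- `main : X² q^{2^{j+2}} ≤ X^{2^{j+2}} · X · (z B² z)`; cancel one factor `X`
    have e2 : (X * q ^ (2 ^ (j + 1))) ^ 2 = X * (X * q ^ (2 ^ (j + 1 + 1))) := by ring
    have e3 : (X ^ (2 ^ (j + 1))) ^ 2 * (X * (z ⬝ᵥ ((A ^ (2 ^ (j + 2))) *ᵥ z)))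
        = X * (X ^ (2 ^ (j + 1 + 1)) * (z ⬝ᵥ ((A ^ (2 ^ (j + 1 + 1))) *ᵥ z))) := by
      rw [show j + 1 + 1 = j + 2 by ring]; ring
    rw [e2, e3] at main
    rcases hz.lt_or_eq with hpos | hzero
    · exact le_of_mul_le_mul_left main hpos
    · -- z = 0
      rw [← hzero]
      simp

/-- THE TRACE CONTROLS THE QUADRATIC FORM (no eigenvalues): for symmetric `A`, every `z` and every
`L = 2^{j+2}` one has `(zᵀAz)^L ≤ ‖z‖^{2L} · tr(A^L)`, i.e. `|zᵀAz| ≤ ‖z‖² · tr(A^L)^{1/L}`.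
This is Lemma 2(b) of PROOF-SFM-BL with `tr(A^L)^{1/L}` in place of `λ_max`. -/
theorem quadForm_pow_le_trace [DecidableEq ι] (A : Matrix ι ι ℝ) (hA : A.IsSymm) (z : ι → ℝ)
    (j : ℕ) :
    (z ⬝ᵥ (A *ᵥ z)) ^ (2 ^ (j + 2)) ≤ (z ⬝ᵥ z) ^ (2 ^ (j + 2)) * (A ^ (2 ^ (j + 2))).trace := by
  have hz : 0 ≤ z ⬝ᵥ z := by
    simpa [dotProduct, pow_two] using Finset.sum_nonneg (fun i _ => mul_self_nonneg (z i))
  set X : ℝ := z ⬝ᵥ z with hX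
  set q : ℝ := z ⬝ᵥ (A *ᵥ z) with hq
  set l : ℕ := 2 ^ (j + 1) with hl
  have hl2 : 2 ^ (j + 2) = 2 * l := by rw [hl]; ring
  have h1 : X * q ^ l ≤ X ^ l * (z ⬝ᵥ ((A ^ l) *ᵥ z)) := quadForm_pow_le A hA z j
  have hL : 0 ≤ X * q ^ l := by
    have : 0 ≤ q ^ l := by rw [hl, pow_succ, pow_mul]; positivity
    exact mul_nonneg hz this
  have hsq : (X * q ^ l) ^ 2 ≤ (X ^ l * (z ⬝ᵥ ((A ^ l) *ᵥ z))) ^ 2 := pow_le_pow_left₀ hL h1 2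
  have hfrob := quadForm_sq_le_frobenius (A ^ l) z
  rw [sum_sq_pow_eq_trace A hA l] at hfrob
  -- hfrob : (z (A^l) z)² ≤ X² · tr(A^{2l})
  have main : (X * q ^ l) ^ 2 ≤ (X ^ l) ^ 2 * (X ^ 2 * (A ^ (2 * l)).trace) := by
    calc (X * q ^ l) ^ 2 ≤ (X ^ l * (z ⬝ᵥ ((A ^ l) *ᵥ z))) ^ 2 := hsq
      _ = (X ^ l) ^ 2 * (z ⬝ᵥ ((A ^ l) *ᵥ z)) ^ 2 := by ring
      _ ≤ (X ^ l) ^ 2 * (X ^ 2 * (A ^ (2 * l)).trace) :=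
          mul_le_mul_of_nonneg_left hfrob (by positivity)
  rw [hl2]
  have e1 : (X * q ^ l) ^ 2 = X ^ 2 * q ^ (2 * l) := by ring
  have e2 : (X ^ l) ^ 2 * (X ^ 2 * (A ^ (2 * l)).trace) = X ^ 2 * (X ^ (2 * l) * (A ^ (2 * l)).trace) := by
    ring
  rw [e1, e2] at main
  rcases hz.lt_or_eq with hpos | hzero
  · exact le_of_mul_le_mul_left main (by positivity)
  · -- z = 0: then q = 0 as well
    have hz0 : z = 0 := by
      have : z ⬝ᵥ z = 0 := hzero.symm
      exact dotProduct_self_eq_zero.mp this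
    have hq0 : q = 0 := by rw [hq, hz0]; simp
    have hl0 : 0 < 2 * l := by rw [hl]; positivity
    rw [hq0, ← hzero, zero_pow hl0.ne', zero_mul]

end Summit.PneNP.PneNP.Theorems.SfmBl
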